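import Literature.Barriers.CriticalPhenomena.ParafermionicHalfCauchyRiemann
import Literature.Probability.RandomPlanarGeometry.HexSAW

/-!
# Objects of the line `differentiated-sum-rule` for the crux `HexTight` (stmt-CriticalPhenomena-5423)

Objects-only module of the line `differentiated-sum-rule` (crux `HexTight`,
`Summit.CriticalPhenomena.SAWScalingLimit.Theses.SAWDevelopingMap.HexTight`, item
stmt-CriticalPhenomena-5423; checked skeleton
`Summits/CriticalPhenomena/SAWScalingLimit/Cruxes/HexTight/Lines/differentiated-sum-rule.lean`, §A).
This file only DEFINES the finite lattice objects the line's lever `SignedVisitingBound` (stub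
`stub_signedVisitingBound`) speaks about, with bodies byte-identical to §A of the skeleton, so that
the stub file `…Theorems.SAWDevelopingMapHexTightSignedVisitingBound` and the skeleton share one
copy of them. NO statement of the line is asserted or named here; the only theorem is the termwise API
inequality `visitMass_le_zmass` (the registered sub-goal this file carries).

Objects (induced honeycomb domains `Λ : Finset HexVertex`, lattice units; walks between mid-edges
`HexMidEdgeSAW Λ a z` of `Literature/Probability/RandomPlanarGeometry/HexParafermion.lean`, the
neighbour finset `HexGreen.nbrs` of `Literature/Barriers/CriticalPhenomena/ParafermionicHalfCauchyRiemann.lean`):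

* `xc = x_c = 1/√(2+√2)` (`hexCriticalFugacity`);
* `zmass Λ a z = Σ_{γ ⊂ Λ : a → z} x_c^{ℓ(γ)}`;
* `Visits γ U` — the walk visits the vertex set `U`; `visitMass`, `signedVisitMass` — the unsigned /
  phase-weighted (`cos((3/8)W_γ − φ)`) `x_c`-mass of the `U`-visiting walks `a → z`;
* `mainSigned`, `mainVisitMass` — sums of the latter over the exits `s(y, w)` of `Λ ∖ U` leaving `Λ`;
* `doorMass` — `Σ_{door mid-edges p of U} Z_{Λ∖U}(a → p)`; `wallMass` — `Σ_{walls q of U} Z_Λ(a → q)`.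

Source of the objects: H. Duminil-Copin, S. Smirnov, Ann. of Math. 175 (2012) (arXiv:1007.0575),
§1–2 (walks between mid-edges, weight `x_c^ℓ`, winding `W_γ`).
-/

noncomputable section

open Literature.Probability.RandomPlanarGeometry Literature.Probability.RandomPlanarGeometry.SAW
  Literature.Probability.LatticeModels
open Literature.Barriers.CriticalPhenomena
open scoped BigOperators Classical

namespace Summit.CriticalPhenomena.SAWScalingLimit.Theorems.HexTight.SumRule

/-- `x_c = 1/√(2+√2)`. -/
abbrev xc : ℝ := hexCriticalFugacity

/-- The `x_c`-mass `Z_Λ(a → z) = Σ_{γ ⊂ Λ : a → z} x_c^{ℓ(γ)}` of the self-avoiding walks of the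
domain `Λ` between the mid-edges `a` and `z` (`= F(a, z, x_c, 0)`, an upper bound for `|F(a,z,x_c,σ)|`
by `norm_hexParafermionicObservable_le`). -/
def zmass (Λ : Finset HexVertex) (a z : Sym2 HexVertex) : ℝ :=
  ∑ γ : HexMidEdgeSAW Λ a z, xc ^ γ.length

/-- The walk `γ` visits the vertex set `U`. -/
def Visits {Λ : Finset HexVertex} {a z : Sym2 HexVertex} (γ : HexMidEdgeSAW Λ a z)
    (U : Finset HexVertex) : Prop :=
  ∃ y ∈ γ.verts, y ∈ U

/-- Unsigned visiting mass: `Σ_{γ ⊂ Λ : a → z, γ ∩ U ≠ ∅} x_c^{ℓ(γ)}`. -/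
def visitMass (Λ U : Finset HexVertex) (a z : Sym2 HexVertex) : ℝ :=
  ∑ γ : HexMidEdgeSAW Λ a z, if Visits γ U then xc ^ γ.length else 0

/-- Signed visiting mass: `Σ_{γ ⊂ Λ : a → z, γ ∩ U ≠ ∅} cos((3/8)·W_γ − φ) x_c^{ℓ(γ)}` — the real
part, in the direction `φ`, of the MAIN side of the strong-Markov identity after division by the
entrance half-edge vector `d_a` (per walk `(mid(z) − c(v_n)) e^{-i(5/8)W_γ} = d_a e^{i(3/8)W_γ}`). -/
def signedVisitMass (Λ U : Finset HexVertex) (a z : Sym2 HexVertex) (φ : ℝ) : ℝ :=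
  ∑ γ : HexMidEdgeSAW Λ a z,
    if Visits γ U then Real.cos (3 / 8 * γ.winding - φ) * xc ^ γ.length else 0

/-- MAIN side of the identity (signed): sum over the boundary mid-edges `s(y, w)` of `Λ ∖ U` that
LEAVE `Λ` (`y ∈ Λ ∖ U`, `w ∉ Λ`, `w ∼ y`) of the signed `U`-visiting mass of walks of `Λ` from `a`. -/
def mainSigned (Λ U : Finset HexVertex) (a : Sym2 HexVertex) (φ : ℝ) : ℝ :=
  ∑ y ∈ Λ \ U, ∑ w ∈ (HexGreen.nbrs y).filter (fun w => w ∉ Λ), signedVisitMass Λ U a s(y, w) φ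

/-- MAIN side, unsigned: total mass of walks of `Λ` from `a` visiting `U` and ending at ANY exit of
`Λ ∖ U` that leaves `Λ`. -/
def mainVisitMass (Λ U : Finset HexVertex) (a : Sym2 HexVertex) : ℝ :=
  ∑ y ∈ Λ \ U, ∑ w ∈ (HexGreen.nbrs y).filter (fun w => w ∉ Λ), visitMass Λ U a s(y, w)

/-- DOOR mass: `Σ_{p ∈ door(U)} Z_{Λ∖U}(a → p)` over the mid-edges `p = s(y, w)`, `y ∈ Λ ∖ U`,
`w ∈ U` — walks of the SMALLER domain ending at the door of `U` (one-way enders). -/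
def doorMass (Λ U : Finset HexVertex) (a : Sym2 HexVertex) : ℝ :=
  ∑ y ∈ Λ \ U, ∑ w ∈ (HexGreen.nbrs y).filter (fun w => w ∈ U), zmass (Λ \ U) a s(y, w)

/-- WALL mass: `Σ_{q ∈ walls(U)} Z_Λ(a → q)` over the boundary mid-edges `q = s(y, w)` of `Λ` hanging
off `U` (`y ∈ U`, `w ∉ Λ`) — walks of `Λ` ending on the walls of `U` (one-way enders). -/
def wallMass (Λ U : Finset HexVertex) (a : Sym2 HexVertex) : ℝ :=
  ∑ y ∈ U, ∑ w ∈ (HexGreen.nbrs y).filter (fun w => w ∉ Λ), zmass Λ a s(y, w)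

/-! ## Termwise API (the registered sub-goal this objects file carries) -/

/-- The `U`-visiting mass of the walks `a → z` is at most their total `x_c`-mass:
`visitMass Λ U a z ≤ zmass Λ a z` (termwise, `x_c ≥ 0`). -/
theorem visitMass_le_zmass : ∀ (Λ U : Finset HexVertex) (a z : Sym2 HexVertex),
    visitMass Λ U a z ≤ zmass Λ a z := by
  intro Λ U a z
  unfold visitMass zmass
  refine Finset.sum_le_sum fun γ _ => ?_
  split_ifs
  · exact le_rfl
  · exact pow_nonneg hexCriticalFugacity_pos_lt_one.1.le _

end Summit.CriticalPhenomena.SAWScalingLimit.Theorems.HexTight.SumRule
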